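import Summits.RiemannHypothesis.RiemannHypothesis.Theses.SpectralTrace
import Summits.RiemannHypothesis.RiemannHypothesis.Theorems.SpectralTraceSpectralIsHpSpectrumPeak
import Summits.RiemannHypothesis.RiemannHypothesis.Theorems.SpectralTraceSpectralIsHpSpectrumCount
import Summits.RiemannHypothesis.RiemannHypothesis.Theorems.SpectralIsHpSpectrum.Negative.RefutationImpliesRH
import Summits.RiemannHypothesis.RiemannHypothesis.Theorems.WindowTraceArch.Negative.ComplexSpectrum
import HarnessLib

/-!
# RiemannHypothesis / SpectralTrace — the crux `SpectralIsHpSpectrum` (rigidity of real Weil spectra)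

Route `RiemannHypothesis/SpectralTrace`, item stmt-RiemannHypothesis-0195 (`SpectralIsHpSpectrum`,
crux, rank 5):

  `∀ (ι : Type) (γ : ι → ℝ), (∀ Weil g, HasSum (i ↦ ĝ(1/2 + iγ_i)) (W g)) →
     ∀ z, {i | 1/2 + iγ_i = z}.encard = 𝟙_{non-trivial zeros}(z) · analyticOrderNatAt ζ z`.

Any real family reproducing the Weil functional `W` on every Weil test IS the multiset of
ordinates of the non-trivial zeros of `ζ`, counted with multiplicity.

Proof = the lead's skeleton `Cruxes/SpectralIsHpSpectrum/Lines/self_majorant_peak.lean` with both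
registered stubs landed (line `self-majorant-peak`, crux-ideate ideator 2 gen 2, kernel-checked
evidence `Cruxes/SpectralIsHpSpectrum/SelfMajorantComplete.lean`; reduction by the standing
disprover, `Cruxes/SpectralIsHpSpectrum/Disproof.lean` §1–§2):

1. The hypothesis proves RH (`riemannHypothesis_of_trace`,
   `Theorems/SpectralIsHpSpectrum/Negative/RefutationImpliesRH`: Bochner form + Weil's criterion).
2. Off the critical line the fibre is empty and, under RH, `z` is not a non-trivial zero
   (`eq_half_add_of_riemannHypothesis`): both sides are `0`.
3. On the line, `z = 1/2 + iτ` and the fibre is `{i | γ_i = τ}`. Under RH the ordinates of the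
   non-trivial zeros repeated `m(ρ)` times are a second real spectrum of `W`
   (`hasSum_weilMellin_zeros`, `eq_half_add_of_riemannHypothesis`); STUB 1 `stub_encardFibreEq`
   (`Theorems/SpectralTraceSpectralIsHpSpectrumPeak`: self-majorised Tannery peak limit — two real
   spectra of one functional have equal fibre `encard`s) compares the two fibres, and STUB 2
   `stub_encardOrdinatesFibre` (`Theorems/SpectralTraceSpectralIsHpSpectrumCount`) evaluates the
   canonical one as the crux's right-hand side.

References: A. Connes, Selecta Math. 5 (1999) 29–106, Thm 1 / Cor 2 (spectrum = critical
ordinates with multiplicity); R. Meyer, Duke Math. J. 127 (2005), p. 3; E. Bombieri, Rend. Lincei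
(9) 11 (2000) 183–233 (explicit formula, Weil's criterion).
-/

noncomputable section

open Complex Set MeasureTheory Filter

namespace Summit.RiemannHypothesis.RiemannHypothesis.Theorems

open Literature.NumberTheory.LFunctions
open Summit.RiemannHypothesis.RiemannHypothesis.Theorems.WindowTraceArch.Negative
open Summit.RiemannHypothesis.RiemannHypothesis.Theorems.SpectralIsHpSpectrum
open Summit.RiemannHypothesis.RiemannHypothesis.Theorems.SpectralIsHpSpectrum.Negative
open Summit.RiemannHypothesis.RiemannHypothesis.Theses.SpectralTrace (SpectralIsHpSpectrum)

/-- **The crux `SpectralIsHpSpectrum` (stmt-RiemannHypothesis-0195).** A real family `γ`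
reproducing the Weil functional on every Weil test has, over every `z : ℂ`, fibre count
`{i | 1/2 + iγ_i = z}.encard` equal to the multiplicity of `z` as a non-trivial zero of `ζ`
(composition `SpectralIsHpSpectrum_of` of the line `self-majorant-peak` with its two landed stubs
`stub_encardFibreEq`, `stub_encardOrdinatesFibre`). [folklore] -/
theorem spectralIsHpSpectrum_proof : SpectralIsHpSpectrum := by
  intro ι γ hγ z
  have hRH : _root_.RiemannHypothesis := riemannHypothesis_of_trace hγ
  by_cases hz : z.re = 1 / 2
  · -- on the critical line: `z = 1/2 + iτ`
    obtain ⟨τ, rfl⟩ : ∃ τ : ℝ, z = 1 / 2 + (τ : ℂ) * I :=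
      ⟨z.im, by apply Complex.ext <;> simp [hz]⟩
    have hfib : {i : ι | (1 / 2 : ℂ) + (γ i : ℂ) * I = 1 / 2 + (τ : ℂ) * I} = {i | γ i = τ} := by
      ext i
      simp only [Set.mem_setOf_eq]
      constructor
      · intro h
        have := congrArg Complex.im h
        simpa using this
      · intro h
        rw [h]
    -- the canonical real spectrum of `W` under RH
    have hord : ∀ g : ℝ → ℂ, IsWeilTest g →
        HasSum (fun p : (Σ ρ : ZetaZeros.riemannZetaNontrivialZeros,
          Fin (riemannZetaZeroOrder (ρ : ℂ)).toNat) =>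
            weilMellin g (1 / 2 + (((p.1 : ℂ).im : ℝ) : ℂ) * I)) (weilFunctional g) :=
      fun g hg => by
        simpa only [eq_half_add_of_riemannHypothesis hRH] using hasSum_weilMellin_zeros hg
    have key := stub_encardFibreEq ι (Σ ρ : ZetaZeros.riemannZetaNontrivialZeros,
      Fin (riemannZetaZeroOrder (ρ : ℂ)).toNat) γ (fun p => (p.1 : ℂ).im) weilFunctional hγ hord τ
    rw [hfib, key]
    exact stub_encardOrdinatesFibre hRH τ
  · -- off the critical line both sides vanish
    have hfib : {i : ι | (1 / 2 : ℂ) + (γ i : ℂ) * I = z} = ∅ := by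
      ext i
      simp only [Set.mem_setOf_eq, Set.mem_empty_iff_false, iff_false]
      intro h
      apply hz
      have := congrArg Complex.re h
      simp at this
      linarith
    have hnot : z ∉ ZetaZeros.riemannZetaNontrivialZeros := by
      intro hmem
      apply hz
      have h1 := eq_half_add_of_riemannHypothesis hRH ⟨z, hmem⟩
      have := congrArg Complex.re h1
      simp at this
      linarith
    rw [hfib, Set.encard_empty, Set.indicator_of_notMem hnot]

end Summit.RiemannHypothesis.RiemannHypothesis.Theorems

end
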